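import Summits.BirchSwinnertonDyer.BirchSwinnertonDyer.Theses.TameQuarticManinParity
import Literature.NumberTheory.GaloisRepresentations.ChebotarevOpenSubgroup
import Literature.NumberTheory.GaloisRepresentations.ResidualGaloisRep
import Literature.NumberTheory.GaloisRepresentations.FramedRepEquivConj
import Literature.RepresentationTheory.Semisimple.FinTwoSemisimplification
import Literature.RepresentationTheory.Semisimple.SubrepresentationEquiv
import Literature.NumberTheory.EllipticCurves.NewformGaloisRepThm61OfNewformProofs
import Mathlib.LinearAlgebra.Matrix.Charpoly.Coeff
import HarnessLib

/-!
# Route `TameQuarticManinParity`: X35 `FramedRepConjugateOfCongruentFrobenius` (stmt-BirchSwinnertonDyer-23869) BY NAME —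
# mod-`λ` rigidity of framed Galois representations over a discrete field (Chebotarev + Brauer–Nesbitt)

Seat `bsd-line-ttd-p1` g12 (explicit-unit on the planner-of-record's TQMP LINE 35, bsd-idea-3 g10).  X35 is the one
open, `W`-free and newform-free leaf of LINE 35: for a field `k` with the DISCRETE topology, two continuous framed
representations `ρ₁, ρ₂ : Γ_ℚ → GL₂(k)` with `ρ₁` irreducible (over `k`) which, at every finite place `v` with
`p_v ∤ N` (`N ≠ 0`), are unramified with a COMMON Frobenius characteristic polynomial, are conjugate:
`ρ₂ = A ρ₁ A⁻¹`.  This is Darmon–Diamond–Taylor 1995, Prop. 2.6 / Serre 1968, I-2.3, read modulo `λ`; with the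
pen's PROVED glue R35 (`X35 → RIG35`) and G35 (`thm61 → RIG35 → CONG∞`) it closes the Galois leaf CONG∞
(stmt-23841) of LINE 34 modulo Deligne's named fact.

PROOF (every ingredient is a tree theorem).
(1) *Equal characteristic polynomials on all of `Γ_ℚ`.*  `k` is discrete, so `K₀ = ker ρ₁ ∩ ker ρ₂` is an open normal
subgroup; the Chebotarev coset lemma `exists_isArithFrobAt_mul_inv_mem_not_mem` (unconditional in the tree) gives, for
every `σ ∈ Γ_ℚ`, a place `v` with `p_v ∤ N` and an arithmetic Frobenius `φ` at `v` with `φ σ⁻¹ ∈ K₀`; hence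
`charpoly ρ₁(σ) = charpoly ρ₁(φ) = P_v = charpoly ρ₂(φ) = charpoly ρ₂(σ)` (pattern of the tree's
`FramedGaloisRep.charpoly_eq_of_isResidualRepOf_of_congruent` and `exists_prime_frobTwin`).
(2) *`ρ₂` is irreducible.*  Pure group theory in rank two (`isIrreducible_glRepresentation_of_charpoly_eq`): if the
representation of a group `G` on `k²` through `τ : G → GL₂(k)` had a stable line, with eigencharacter `χ₁` and
`χ₂ = det τ / χ₁`, the DIAGONAL representation `diag(χ₁, χ₂)` (the rank-two semisimplification of the tree's
`exists_semisimplification_fin_two`, rebuilt here with its diagonal shape exposed) is semisimple with the same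
characteristic polynomials as `τ`, hence as the irreducible `σ`; Brauer–Nesbitt over an arbitrary field
(`brauerNesbitt_holds`, Bourbaki A VIII §20 n°6) makes it equivalent to `σ`, hence irreducible
(`Representation.isIrreducible_of_equiv`) — but its coordinate line `k e₀` is stable, non-zero and proper.
(3) *Brauer–Nesbitt again* gives an equivalence of the representations of `Γ_ℚ` on `k²` through `ρ₁` and `ρ₂`,
automatically bicontinuous (`k²` is discrete), and `FramedRep.exists_eq_conj_of_equiv` turns it into a conjugating
matrix.  THEOREMS ONLY: no definition, no named fact, no `sorry`.  No summit is proved; BSD is NOT proved.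
-/

set_option autoImplicit false
-- D-0017: single-problem summit, so `Summit.BirchSwinnertonDyer.BirchSwinnertonDyer.…` repeats a namespace BY DESIGN.
set_option linter.dupNamespace false

noncomputable section

namespace Summit.BirchSwinnertonDyer.BirchSwinnertonDyer.Theorems.TameQuarticManinParity

open Summit.BirchSwinnertonDyer.BirchSwinnertonDyer.Theses.TameQuarticManinParity

open scoped MatrixGroups NumberField
open Matrix Polynomial Module
open Literature.NumberTheory.GaloisRepresentations Literature.RepresentationTheory.Semisimple

/-! ### Rank-two group theory over a field: irreducibility is detected by characteristic polynomials -/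

section RankTwo

variable {k : Type*} [Field k] {G : Type*} [Group G]

/-- **A reducible representation on `k²` has a diagonal companion with the same characteristic polynomials.**
If the representation of `G` on `k²` through `τ : G → GL₂(k)` is NOT irreducible, there is a homomorphism
`ψ : G → GL₂(k)` by DIAGONAL matrices with `det(X - ψ(g)) = det(X - τ(g))` for all `g` (a stable line `k w`
with eigencharacter `χ₁`, `χ₂ = det τ / χ₁`, `ψ = diag(χ₁, χ₂)`; the eigenvalue relation is Cayley–Hamilton,
`sq_sub_trace_mul_add_det_eq_zero`).  This is the reducible branch of the tree's
`exists_semisimplification_fin_two` (Curtis–Reiner I §16B; Deligne–Serre 1974, 6.12) with the diagonal shape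
kept in the statement. [cite: DeligneSerreASENS1974, 6.12] -/
theorem exists_diagonal_charpoly_eq_of_not_isIrreducible (τ : G →* GL (Fin 2) k)
    (hτ : ¬ (glRepresentation τ).IsIrreducible) :
    ∃ ψ : G →* GL (Fin 2) k,
      (∀ g, ∃ d : Fin 2 → k, ((ψ g : GL (Fin 2) k) : Matrix (Fin 2) (Fin 2) k) = Matrix.diagonal d) ∧
      (∀ g, ((ψ g : GL (Fin 2) k) : Matrix (Fin 2) (Fin 2) k).charpoly =
        ((τ g : GL (Fin 2) k) : Matrix (Fin 2) (Fin 2) k).charpoly) := by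
  classical
  -- adapted from Literature/RepresentationTheory/Semisimple/FinTwoSemisimplification
  -- (`exists_semisimplification_fin_two`, reducible branch)
  set R := glRepresentation τ with hR
  have hRapply : ∀ (g : G) (v : Fin 2 → k),
      R g v = ((τ g : GL (Fin 2) k) : Matrix (Fin 2) (Fin 2) k) *ᵥ v := fun _ _ ↦ rfl
  -- a stable line `k w`
  have hbot : (⊥ : Subrepresentation R).toSubmodule = ⊥ := rfl
  have htop : (⊤ : Subrepresentation R).toSubmodule = ⊤ := rfl
  have hbt : (⊥ : Subrepresentation R) ≠ ⊤ := by
    intro h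
    have h' := congrArg Subrepresentation.toSubmodule h
    rw [hbot, htop] at h'
    exact bot_ne_top h'
  obtain ⟨W, hW0, hW1⟩ : ∃ W : Subrepresentation R, W ≠ ⊥ ∧ W ≠ ⊤ := by
    by_contra hcon
    push Not at hcon
    haveI : Nontrivial (Subrepresentation R) := ⟨⟨⊥, ⊤, hbt⟩⟩
    exact hτ ⟨fun W ↦ or_iff_not_imp_left.mpr (hcon W)⟩
  have hW0' : W.toSubmodule ≠ ⊥ := fun h ↦ hW0 (Subrepresentation.toSubmodule_injective
    (by rw [h, hbot]))
  have hW1' : W.toSubmodule ≠ ⊤ := fun h ↦ hW1 (Subrepresentation.toSubmodule_injective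
    (by rw [h, htop]))
  have hWrank : finrank k W.toSubmodule = 1 := finrank_eq_one_of_ne_bot_of_ne_top hW0' hW1'
  obtain ⟨w, hwW, hw0⟩ := Submodule.exists_mem_ne_zero_of_ne_bot hW0'
  -- every element of `W` is a multiple of `w`
  have hmult : ∀ v ∈ W.toSubmodule, ∃ c : k, c • w = v := by
    intro v hv
    have h1 := (finrank_eq_one_iff_of_nonzero' (⟨w, hwW⟩ : W.toSubmodule)
      (by exact_mod_cast Subtype.coe_ne_coe.mp hw0 : (⟨w, hwW⟩ : W.toSubmodule) ≠ 0)).mp hWrank ⟨v, hv⟩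
    obtain ⟨c, hc⟩ := h1
    exact ⟨c, by simpa using congrArg Subtype.val hc⟩
  -- the eigencharacter `χ₁`
  have hex : ∀ g : G, ∃ c : k, c • w = R g w := fun g ↦ hmult _ (W.apply_mem_toSubmodule g hwW)
  choose χ hχ using hex
  have hχne : ∀ g, χ g ≠ 0 := by
    intro g hg
    have h1 : R g w = 0 := by rw [← hχ g, hg, zero_smul]
    have h2 : w = 0 := by
      have := congrArg (R g⁻¹) h1
      rwa [map_zero, ← Module.End.mul_apply, ← map_mul, inv_mul_cancel, map_one,
        Module.End.one_apply] at this
    exact hw0 h2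
  have hχmul : ∀ g h, χ (g * h) = χ g * χ h := by
    intro g h
    apply smul_left_injective k hw0
    change χ (g * h) • w = (χ g * χ h) • w
    rw [hχ, map_mul, Module.End.mul_apply, ← hχ h, map_smul, ← hχ g, smul_smul, mul_comm]
  have hχone : χ 1 = 1 := by
    apply smul_left_injective k hw0
    change χ 1 • w = (1 : k) • w
    rw [hχ, map_one, Module.End.one_apply, one_smul]
  let χ₁ : G →* kˣ :=
    { toFun := fun g ↦ Units.mk0 (χ g) (hχne g)
      map_one' := Units.ext hχone
      map_mul' := fun g h ↦ Units.ext (hχmul g h) }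
  have hχ₁ : ∀ g, ((χ₁ g : kˣ) : k) = χ g := fun _ ↦ rfl
  -- the determinant character and `χ₂ = det / χ₁`
  let δ : G →* kˣ := Matrix.GeneralLinearGroup.det.comp τ
  have hδ : ∀ g, ((δ g : kˣ) : k) = ((τ g : GL (Fin 2) k) : Matrix (Fin 2) (Fin 2) k).det :=
    fun _ ↦ rfl
  let χ₂ : G →* kˣ := δ * χ₁⁻¹
  have hχ₂ : ∀ g, ((χ₂ g : kˣ) : k) = ((τ g : GL (Fin 2) k) : Matrix (Fin 2) (Fin 2) k).det * (χ g)⁻¹ :=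
    fun g ↦ by simp [χ₂, hδ, hχ₁]
  -- the eigenvalue relation: `χ(g)² - tr χ(g) + det = 0`
  have hroot : ∀ g, χ g ^ 2 - ((τ g : GL (Fin 2) k) : Matrix (Fin 2) (Fin 2) k).trace * χ g +
      ((τ g : GL (Fin 2) k) : Matrix (Fin 2) (Fin 2) k).det = 0 := fun g ↦
    sq_sub_trace_mul_add_det_eq_zero hw0 (by rw [← hRapply, ← hχ g])
  -- `ψ = diag(χ₁, χ₂)`
  obtain ⟨D, hD⟩ := exists_diagonalHom (k := k)
  let ψ : G →* GL (Fin 2) k := D.comp (χ₁.prod χ₂)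
  have hψ : ∀ g, ((ψ g : GL (Fin 2) k) : Matrix (Fin 2) (Fin 2) k) =
      Matrix.diagonal ![χ g, ((τ g : GL (Fin 2) k) : Matrix (Fin 2) (Fin 2) k).det * (χ g)⁻¹] := by
    intro g
    change ((D (χ₁ g, χ₂ g) : GL (Fin 2) k) : Matrix (Fin 2) (Fin 2) k) = _
    rw [hD, hχ₁, hχ₂]
  refine ⟨ψ, fun g ↦ ⟨_, hψ g⟩, fun g ↦ ?_⟩
  -- same characteristic polynomial: compare trace and determinant
  rw [Matrix.charpoly_fin_two, Matrix.charpoly_fin_two, hψ]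
  have htr : (Matrix.diagonal ![χ g, ((τ g : GL (Fin 2) k) : Matrix (Fin 2) (Fin 2) k).det * (χ g)⁻¹]).trace =
      ((τ g : GL (Fin 2) k) : Matrix (Fin 2) (Fin 2) k).trace := by
    rw [Matrix.trace_fin_two]
    simp only [Matrix.diagonal_apply_eq, Matrix.cons_val_zero, Matrix.cons_val_one]
    have h1 := hroot g
    have hinv : χ g * (χ g)⁻¹ = 1 := mul_inv_cancel₀ (hχne g)
    linear_combination (χ g)⁻¹ * h1 -
      (χ g - ((τ g : GL (Fin 2) k) : Matrix (Fin 2) (Fin 2) k).trace) * hinv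
  have hdet : (Matrix.diagonal ![χ g, ((τ g : GL (Fin 2) k) : Matrix (Fin 2) (Fin 2) k).det * (χ g)⁻¹]).det =
      ((τ g : GL (Fin 2) k) : Matrix (Fin 2) (Fin 2) k).det := by
    rw [Matrix.det_diagonal, Fin.prod_univ_two]
    simp only [Matrix.cons_val_zero, Matrix.cons_val_one]
    rw [← mul_assoc, mul_comm (χ g), mul_assoc, mul_inv_cancel₀ (hχne g), mul_one]
  rw [htr, hdet]

/-- **A representation on `k²` by diagonal matrices is not irreducible**: the coordinate line `k e₀` is a
stable, non-zero, proper subspace (`diagonal_mulVec_mem_span_single`). [folklore] -/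
theorem not_isIrreducible_glRepresentation_of_diagonal (ψ : G →* GL (Fin 2) k)
    (hψ : ∀ g, ∃ d : Fin 2 → k, ((ψ g : GL (Fin 2) k) : Matrix (Fin 2) (Fin 2) k) = Matrix.diagonal d) :
    ¬ (glRepresentation ψ).IsIrreducible := by
  classical
  intro hirr
  set R := glRepresentation ψ with hR
  have hRapply : ∀ (g : G) (v : Fin 2 → k),
      R g v = ((ψ g : GL (Fin 2) k) : Matrix (Fin 2) (Fin 2) k) *ᵥ v := fun _ _ ↦ rfl
  -- the coordinate line `k e₀` as a subrepresentation
  let L : Subrepresentation R :=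
    ⟨k ∙ (Pi.single 0 1 : Fin 2 → k), fun g v hv ↦ by
      obtain ⟨d, hd⟩ := hψ g
      rw [hRapply, hd]
      exact diagonal_mulVec_mem_span_single d 0 hv⟩
  have hLsub : L.toSubmodule = k ∙ (Pi.single 0 1 : Fin 2 → k) := rfl
  have hbot : (⊥ : Subrepresentation R).toSubmodule = ⊥ := rfl
  have htop : (⊤ : Subrepresentation R).toSubmodule = ⊤ := rfl
  haveI : IsSimpleOrder (Subrepresentation R) := hirr
  rcases IsSimpleOrder.eq_bot_or_eq_top L with h | h
  · -- `L = ⊥`: but `e₀ ∈ L` is non-zero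
    have hmem : (Pi.single 0 1 : Fin 2 → k) ∈ L.toSubmodule :=
      hLsub ▸ Submodule.mem_span_singleton_self _
    rw [h, hbot, Submodule.mem_bot] at hmem
    have := congr_fun hmem 0
    simp at this
  · -- `L = ⊤`: but `e₁ ∉ k e₀`
    have hmem : (Pi.single 1 1 : Fin 2 → k) ∈ L.toSubmodule := by
      rw [h, htop]; exact Submodule.mem_top
    rw [hLsub, Submodule.mem_span_singleton] at hmem
    obtain ⟨c, hc⟩ := hmem
    have := congr_fun hc 1
    simp at this

/-- The characteristic polynomial of `glRepresentation τ g`, as a linear map of `k²`, is the matrix characteristic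
polynomial of `τ g` (Mathlib `Matrix.charpoly_toLin'`). [folklore] -/
theorem charpoly_glRepresentation_apply {n : ℕ} (τ : G →* GL (Fin n) k) (g : G) :
    (glRepresentation τ g : (Fin n → k) →ₗ[k] (Fin n → k)).charpoly =
      ((τ g : GL (Fin n) k) : Matrix (Fin n) (Fin n) k).charpoly := by
  have e : (glRepresentation τ g : (Fin n → k) →ₗ[k] (Fin n → k)) =
      Matrix.toLin' ((τ g : GL (Fin n) k) : Matrix (Fin n) (Fin n) k) :=
    LinearMap.ext fun v => by rw [Matrix.toLin'_apply]; rfl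
  rw [e, Matrix.charpoly_toLin']

/-- **Irreducibility in rank two is detected by characteristic polynomials.**  If `σ : G → GL₂(k)` gives an
irreducible representation of `G` on `k²` and `τ : G → GL₂(k)` has `det(X - τ(g)) = det(X - σ(g))` for all `g`,
then the representation through `τ` is irreducible too: otherwise its diagonal companion
(`exists_diagonal_charpoly_eq_of_not_isIrreducible`) is semisimple (`isSemisimpleRepresentation_diagonal_fin_two`)
with the characteristic polynomials of `σ`, so Brauer–Nesbitt over an arbitrary field (`brauerNesbitt_holds`,
Bourbaki A VIII §20 n°6) makes it equivalent to `σ`, hence irreducible (`Representation.isIrreducible_of_equiv`),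
contradicting `not_isIrreducible_glRepresentation_of_diagonal`.
[cite: DarmonDiamondTaylor1995, §2.1, Prop. 2.6 and p. 54] -/
theorem isIrreducible_glRepresentation_of_charpoly_eq (τ σ : G →* GL (Fin 2) k)
    (hσ : (glRepresentation σ).IsIrreducible)
    (h : ∀ g, ((τ g : GL (Fin 2) k) : Matrix (Fin 2) (Fin 2) k).charpoly =
      ((σ g : GL (Fin 2) k) : Matrix (Fin 2) (Fin 2) k).charpoly) :
    (glRepresentation τ).IsIrreducible := by
  classical
  by_contra hτ
  obtain ⟨ψ, hdiag, hcp⟩ := exists_diagonal_charpoly_eq_of_not_isIrreducible τ hτ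
  have hssψ : (glRepresentation ψ).IsSemisimpleRepresentation :=
    isSemisimpleRepresentation_diagonal_fin_two ψ hdiag
  haveI : IsSimpleOrder (Subrepresentation (glRepresentation σ)) := hσ
  have hssσ : (glRepresentation σ).IsSemisimpleRepresentation :=
    (inferInstance : ComplementedLattice (Subrepresentation (glRepresentation σ)))
  obtain ⟨e⟩ := brauerNesbitt_holds (glRepresentation σ) (glRepresentation ψ) hssσ hssψ fun g => by
    rw [charpoly_glRepresentation_apply, charpoly_glRepresentation_apply, hcp g, h g]
  haveI : (glRepresentation σ).IsIrreducible := hσ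
  exact not_isIrreducible_glRepresentation_of_diagonal ψ hdiag (Representation.isIrreducible_of_equiv e)

end RankTwo

/-! ### Chebotarev: common Frobenius polynomials outside `N` give equal characteristic polynomials everywhere -/

section Chebotarev

open IsDedekindDomain Field Rat.HeightOneSpectrum

variable {k : Type} [Field k] [TopologicalSpace k] [DiscreteTopology k]

/-- The kernel of a framed Galois representation over a DISCRETE field is open. [folklore] -/
theorem isOpen_ker_of_discreteTopology {n : ℕ} (ρ : FramedGaloisRep ℚ k n) :
    IsOpen ((ρ : absoluteGaloisGroup ℚ →* GL (Fin n) k).ker : Set (absoluteGaloisGroup ℚ)) := by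
  have e : ((ρ : absoluteGaloisGroup ℚ →* GL (Fin n) k).ker : Set (absoluteGaloisGroup ℚ)) =
      ρ ⁻¹' {1} := by
    ext g
    simp [MonoidHom.mem_ker]
  rw [e]
  exact (isOpen_discrete _).preimage (map_continuous ρ)

/-- **Chebotarev transport of characteristic polynomials.**  Two framed representations `ρ₁, ρ₂ : Γ_ℚ → GL_n(k)`
over a discrete field which, at every finite place `v` with `p_v ∤ N` (`N ≠ 0`), carry a common Frobenius
characteristic polynomial have `det(X - ρ₁(σ)) = det(X - ρ₂(σ))` for EVERY `σ ∈ Γ_ℚ`: the open normal subgroup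
`K₀ = ker ρ₁ ∩ ker ρ₂` has, by the tree's unconditional Chebotarev coset lemma
`exists_isArithFrobAt_mul_inv_mem_not_mem`, an arithmetic Frobenius `φ` at some `v`, `p_v ∤ N` (a finite set of places,
`DeligneSerre1974.finite_setOf_primesEquiv_dvd`), in every coset `K₀ σ`, and there both characteristic polynomials
are the common `P_v`.
[cite: DarmonDiamondTaylor1995, §2.1, Prop. 2.6 and p. 54] -/
theorem charpoly_eq_of_hasFrobCharpolyAt_of_not_dvd {n : ℕ} (ρ₁ ρ₂ : FramedGaloisRep ℚ k n) {N : ℕ}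
    (hN : N ≠ 0)
    (h : ∀ v : HeightOneSpectrum (𝓞 ℚ), ¬ ((primesEquiv v : Nat.Primes) : ℕ) ∣ N →
      ∃ P : Polynomial k, ρ₁.HasFrobCharpolyAt v P ∧ ρ₂.HasFrobCharpolyAt v P)
    (σ : absoluteGaloisGroup ℚ) :
    (((ρ₁ : absoluteGaloisGroup ℚ →* GL (Fin n) k) σ : GL (Fin n) k) : Matrix (Fin n) (Fin n) k).charpoly =
      (((ρ₂ : absoluteGaloisGroup ℚ →* GL (Fin n) k) σ : GL (Fin n) k) :
        Matrix (Fin n) (Fin n) k).charpoly := by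
  classical
  -- the open normal subgroup `K₀ = ker ρ₁ ∩ ker ρ₂`
  set K₀ : Subgroup (absoluteGaloisGroup ℚ) :=
    (MonoidHom.prod (ρ₁ : absoluteGaloisGroup ℚ →* GL (Fin n) k)
      (ρ₂ : absoluteGaloisGroup ℚ →* GL (Fin n) k)).ker with hK₀
  haveI : K₀.Normal := MonoidHom.normal_ker _
  have hK₀open : IsOpen (K₀ : Set (absoluteGaloisGroup ℚ)) := by
    have e : (K₀ : Set (absoluteGaloisGroup ℚ)) =
        (((ρ₁ : absoluteGaloisGroup ℚ →* GL (Fin n) k).ker : Set (absoluteGaloisGroup ℚ)) ∩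
          ((ρ₂ : absoluteGaloisGroup ℚ →* GL (Fin n) k).ker : Set (absoluteGaloisGroup ℚ))) := by
      ext g
      simp [hK₀, MonoidHom.mem_ker, Prod.ext_iff]
    rw [e]
    exact (isOpen_ker_of_discreteTopology ρ₁).inter (isOpen_ker_of_discreteTopology ρ₂)
  -- Chebotarev: a Frobenius `φ` at a place `v` with `p_v ∤ N` and `φ σ⁻¹ ∈ K₀`
  obtain ⟨v, hvS, -, 𝔓, h𝔓, φ, hφ, hφσ⟩ :=
    exists_isArithFrobAt_mul_inv_mem_not_mem ℚ K₀ hK₀open σ _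
      (Literature.NumberTheory.EllipticCurves.ModularForms.DeligneSerre1974.finite_setOf_primesEquiv_dvd hN)
  have hmem : φ * σ⁻¹ ∈ K₀ := hφσ
  rw [hK₀, MonoidHom.mem_ker, MonoidHom.prod_apply, Prod.mk_eq_one, map_mul, map_mul, map_inv, map_inv,
    mul_inv_eq_one, mul_inv_eq_one] at hmem
  obtain ⟨h₁, h₂⟩ := hmem
  obtain ⟨P, hP₁, hP₂⟩ := h v hvS
  have e₁ : (((ρ₁ : absoluteGaloisGroup ℚ →* GL (Fin n) k) φ : GL (Fin n) k) :
      Matrix (Fin n) (Fin n) k).charpoly = P := hP₁ 𝔓 h𝔓 φ hφ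
  have e₂ : (((ρ₂ : absoluteGaloisGroup ℚ →* GL (Fin n) k) φ : GL (Fin n) k) :
      Matrix (Fin n) (Fin n) k).charpoly = P := hP₂ 𝔓 h𝔓 φ hφ
  rw [← h₁, ← h₂, e₁, e₂]

end Chebotarev

/-! ### X35 by name -/

open IsDedekindDomain Field Rat.HeightOneSpectrum in
/-- **X35 `FramedRepConjugateOfCongruentFrobenius` (stmt-BirchSwinnertonDyer-23869), PROVED** — mod-`λ` rigidity of framed
Galois representations (Darmon–Diamond–Taylor 1995, Prop. 2.6; Serre 1968, I-2.3): over a field `k` with the discrete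
topology, two framed `ρ₁, ρ₂ : Γ_ℚ → GL₂(k)` with `ρ₁` irreducible which, at every finite place `v` with `p_v ∤ N`
(`N ≠ 0`), are unramified with a common Frobenius characteristic polynomial satisfy `ρ₂ = A ρ₁ A⁻¹` for some
`A ∈ GL₂(k)`.  Chebotarev transport (`charpoly_eq_of_hasFrobCharpolyAt_of_not_dvd`) ⇒ equal characteristic
polynomials on `Γ_ℚ`; rank-two irreducibility transfer (`isIrreducible_glRepresentation_of_charpoly_eq`) ⇒ `ρ₂`
irreducible; Brauer–Nesbitt (`brauerNesbitt_holds`) ⇒ the representations on `k²` are equivalent, bicontinuously as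
`k²` is discrete; `FramedRep.exists_eq_conj_of_equiv` ⇒ conjugate.  The unramifiedness hypotheses are not needed.
[cite: DarmonDiamondTaylor1995, §2.1, Prop. 2.6 and p. 54] -/
theorem framedRepConjugateOfCongruentFrobenius_proof : FramedRepConjugateOfCongruentFrobenius := by
  intro k _ _ _ ρ₁ ρ₂ hirr N hN h
  classical
  -- (1) equal characteristic polynomials on `Γ_ℚ`
  have hcp : ∀ σ : absoluteGaloisGroup ℚ,
      (((ρ₂ : absoluteGaloisGroup ℚ →* GL (Fin 2) k) σ : GL (Fin 2) k) : Matrix (Fin 2) (Fin 2) k).charpoly =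
        (((ρ₁ : absoluteGaloisGroup ℚ →* GL (Fin 2) k) σ : GL (Fin 2) k) :
          Matrix (Fin 2) (Fin 2) k).charpoly := fun σ =>
    (charpoly_eq_of_hasFrobCharpolyAt_of_not_dvd ρ₁ ρ₂ hN (fun v hv => (h v hv).2.2) σ).symm
  -- (2) `ρ₁` irreducible (hypothesis), hence `ρ₂` irreducible; both semisimple
  have hirr₁ : (glRepresentation (ρ₁ : absoluteGaloisGroup ℚ →* GL (Fin 2) k)).IsIrreducible := hirr
  have hirr₂ : (glRepresentation (ρ₂ : absoluteGaloisGroup ℚ →* GL (Fin 2) k)).IsIrreducible :=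
    isIrreducible_glRepresentation_of_charpoly_eq _ _ hirr₁ hcp
  haveI : IsSimpleOrder (Subrepresentation
      (glRepresentation (ρ₁ : absoluteGaloisGroup ℚ →* GL (Fin 2) k))) := hirr₁
  haveI : IsSimpleOrder (Subrepresentation
      (glRepresentation (ρ₂ : absoluteGaloisGroup ℚ →* GL (Fin 2) k))) := hirr₂
  have hss₁ : (glRepresentation (ρ₁ : absoluteGaloisGroup ℚ →* GL (Fin 2) k)).IsSemisimpleRepresentation :=
    (inferInstance : ComplementedLattice (Subrepresentation
      (glRepresentation (ρ₁ : absoluteGaloisGroup ℚ →* GL (Fin 2) k))))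
  have hss₂ : (glRepresentation (ρ₂ : absoluteGaloisGroup ℚ →* GL (Fin 2) k)).IsSemisimpleRepresentation :=
    (inferInstance : ComplementedLattice (Subrepresentation
      (glRepresentation (ρ₂ : absoluteGaloisGroup ℚ →* GL (Fin 2) k))))
  -- (3) Brauer–Nesbitt: the representations of `Γ_ℚ` on `k²` through `ρ₁`, `ρ₂` are equivalent
  obtain ⟨e⟩ := brauerNesbitt_holds (glRepresentation (ρ₁ : absoluteGaloisGroup ℚ →* GL (Fin 2) k))
      (glRepresentation (ρ₂ : absoluteGaloisGroup ℚ →* GL (Fin 2) k)) hss₁ hss₂ fun σ => by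
    rw [charpoly_glRepresentation_apply, charpoly_glRepresentation_apply]
    exact (hcp σ).symm
  -- the equivalence is bicontinuous (`k²` is discrete) and exhibits `ρ₂` as a conjugate of `ρ₁`
  have E : ContinuousRep.Equiv (FramedRep.toContinuousRep ρ₁) (FramedRep.toContinuousRep ρ₂) :=
    ⟨e, continuous_of_discreteTopology, continuous_of_discreteTopology⟩
  exact FramedRep.exists_eq_conj_of_equiv ρ₁ ρ₂ E

end Summit.BirchSwinnertonDyer.BirchSwinnertonDyer.Theorems.TameQuarticManinParity

end
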